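import Literature.NumberTheory.Automorphic.ArchWhittakerRieszCovariance
import Mathlib.Analysis.InnerProductSpace.ProdL2
import Mathlib.Analysis.InnerProductSpace.Projection.Submodule
import HarnessLib

/-!
# Pairs of continuous Whittaker functionals on an irreducible unitary representation of
# `GL_n(K_∞)`: the totality dichotomy (Thomas's argument, first half)

Topic `NumberTheory/Automorphic`; namespace `Literature.NumberTheory.Automorphic`.

Let `τ` be an irreducible unitary strongly continuous representation of `G_∞ = GL_n(K_∞)` on the
Hilbert space `E`, and `ℓ₁ ≠ 0`, `ℓ₂` continuous `ψ_∞`-Whittaker functionals on its Gårding space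
(`ArchGardingWhittaker`), with Riesz vectors `ξ^i_α = whittakerRieszVector hcpt τ hτ ℓ_i α`
(`ArchWhittakerRieszVectors`: `⟪ξ^i_α, e⟫ = ℓ_i(τ(α) e)`). In the Hilbert sum `E ⊕ E`
(`WithLp 2 (E × E)`) consider the PAIRS `ξ̂_α = (ξ¹_α, ξ²_α)`. This file PROVES the dichotomy

* `IsArchContWhittakerFunctional.exists_eq_smul_of_orthogonal_pairs_ne_bot`: **if the pairs
  `ξ̂_α` are NOT total in `E ⊕ E`** (their span has a non-zero orthogonal complement), **then
  `ℓ₂ = c • ℓ₁`**.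

Proof (the representation-theoretic half of E. G. F. Thomas's multiplicity-free criterion,
*The theorem of Bochner–Schwartz–Godement for generalised Gelfand pairs* (1984), Thm. E and
Thm. A, specialised to the pair `(ℓ₁, ℓ₂)`): the orthogonal complement `K` of the pairs is closed
and stable under the diagonal unitaries `τ(g) ⊕ τ(g)` (`G_∞`-covariance of the Riesz vectors,
`apply_whittakerRieszVector`, and unitarity), as is `Kᗮ`; hence the orthogonal projection `Q`
onto `K` commutes with `τ(g) ⊕ τ(g)`, so its four blocks commute with `τ(G_∞)` and are scalars
`q_ij` by Schur's lemma (`IsTopIrreducible.exists_apply_eq_smul_of_commute`). Since `Q` kills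
the pairs, `q₁₁ ξ¹_α + q₁₂ ξ²_α = 0 = q₂₁ ξ¹_α + q₂₂ ξ²_α` for all `α` with `(q_ij) ≠ 0`; as
`ℓ₁ ≠ 0` forces some `ξ¹_α ≠ 0`, one gets `ξ²_α = c ξ¹_α` for all `α`, i.e. `ℓ₂ = conj(c) ℓ₁`
(`eq_smul_of_whittakerRieszVector_eq_smul`).

What remains of Shalika's archimedean local multiplicity one (Getz–Hahn (2024), Thm. 11.3.1 for
`F = ℝ`, `G = Res_{K/ℚ} GL_n`) after this file is therefore the OTHER branch: to exclude that the
pairs `ξ̂_α` are total in `E ⊕ E` — which is where the symmetry of positive-definite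
bi-`(N_∞, ψ_∞)`-quasi-invariant distributions under `g ↦ w⁰ ᵗg w⁰` (Shalika (1974), §2;
Gelfand–Kazhdan) enters, through the second half of Thomas's argument (an anti-unitary `J` with
`J A J⁻¹ = A*` on the commutant forces the commutant, here `M₂(ℂ)`, to be commutative). That half is
not done here. No definition and no named fact is introduced.

## References

* E. G. F. Thomas, *The theorem of Bochner–Schwartz–Godement for generalised Gelfand pairs*, in:
  Functional Analysis: Surveys and Recent Results III (K. D. Bierstedt, B. Fuchssteiner, eds.),
  North-Holland Math. Studies 90 (1984), 291–304, Thm. A and Thm. E (pp. 298–301).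
* J. A. Shalika, *The multiplicity one theorem for `GL_n`*, Ann. of Math. 100 (1974), §§2–3
  [Shalika1974].
* A. Aizenbud, D. Gourevitch, E. Sayag, *(GL_{n+1}(F), GL_n(F)) is a Gelfand pair for any local
  field F*, Compos. Math. 144 (2008), §2.3 (Thm. 2.3.1) [arXiv:0709.1273].
-/

noncomputable section

open MeasureTheory Measure NumberField NumberField.mixedEmbedding IsDedekindDomain Set Filter
open scoped MatrixGroups InnerProductSpace Topology Classical ContDiff Matrix.Norms.Operator
  ComplexConjugate

namespace Literature.NumberTheory.Automorphic

variable {n : ℕ} {K : Type} [Field K] [NumberField K]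

attribute [local instance] glInfBorel borelSpace_glInf locallyCompactSpace_glInf
  secondCountableTopology_glInf

-- Mathlib idiom (Mathlib/Algebra/Lie/OfAssociative.lean): the commutator Lie ring on matrices
attribute [local instance 100] LieRing.ofAssociativeRing

-- as in `ArchGardingWhittaker`: the scoped `L∞`-operator normed ring structure on matrices is only
-- reducibly defeq to the Pi uniformity
set_option backward.isDefEq.respectTransparency false

/-! ### 1. Hilbert-space lemmas: invariant subspaces, their orthogonals, and projections -/

section Hilbert

variable {H : Type*} [NormedAddCommGroup H] [InnerProductSpace ℂ H]

/-- If a subspace `L` is stable under an operator `V` then `Lᗮ` is stable under any operator `U`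
with `⟪U x, y⟫ = ⟪x, V y⟫` (an "adjoint on `L`"). [folklore] -/
theorem mem_orthogonal_of_forall_inner_eq {L : Submodule ℂ H} {U V : H →L[ℂ] H}
    (hUV : ∀ x y : H, ⟪U x, y⟫_ℂ = ⟪x, V y⟫_ℂ) (hV : ∀ y ∈ L, V y ∈ L) {x : H} (hx : x ∈ Lᗮ) :
    U x ∈ Lᗮ := by
  rw [Submodule.mem_orthogonal'] at hx ⊢
  intro y hy
  rw [hUV, hx _ (hV y hy)]

/-- **An orthogonal projection commutes with an operator leaving both the subspace and its
orthogonal complement stable.** [folklore] -/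
theorem starProjection_apply_of_stable_orthogonal {L : Submodule ℂ H} [L.HasOrthogonalProjection]
    {U : H →L[ℂ] H} (hL : ∀ x ∈ L, U x ∈ L) (hLo : ∀ x ∈ Lᗮ, U x ∈ Lᗮ) (x : H) :
    L.starProjection (U x) = U (L.starProjection x) := by
  refine Submodule.eq_starProjection_of_mem_orthogonal (hL _ (L.starProjection_apply_mem x)) ?_
  rw [← map_sub]
  exact hLo _ (L.sub_starProjection_mem_orthogonal x)

end Hilbert

/-! ### 2. The diagonal action of `G_∞` on `E ⊕ E` -/

section Diagonal

variable {hcpt : isCompact_glFiniteIntegralLevel n K}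
  {E : Type*} [NormedAddCommGroup E] [InnerProductSpace ℂ E] [CompleteSpace E]
  {τ : ContRepresentation ℂ (AutomorphyDatum.gl n K hcpt).arch.carrier E}

variable (τ) in
/-- The diagonal operator `τ(g) ⊕ τ(g)` on the Hilbert sum `E ⊕ E` (`WithLp 2 (E × E)`),
as a continuous linear map (an abbreviation of Mathlib compositions, not a new notion). [folklore] -/
abbrev diagOp (g : (AutomorphyDatum.gl n K hcpt).arch.carrier) : WithLp 2 (E × E) →L[ℂ] WithLp 2 (E × E) :=
  ((WithLp.prodContinuousLinearEquiv 2 ℂ E E).symm : (E × E) →L[ℂ] WithLp 2 (E × E)) ∘L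
    ((τ g).prodMap (τ g)) ∘L
      ((WithLp.prodContinuousLinearEquiv 2 ℂ E E) : WithLp 2 (E × E) →L[ℂ] (E × E))

omit [CompleteSpace E] in
/-- `(τ(g) ⊕ τ(g)) (x, y) = (τ(g) x, τ(g) y)`. [folklore] -/
@[simp] theorem diagOp_toLp (g : (AutomorphyDatum.gl n K hcpt).arch.carrier) (x y : E) :
    diagOp τ g (WithLp.toLp 2 (x, y)) = WithLp.toLp 2 (τ g x, τ g y) := rfl

omit [CompleteSpace E] in
/-- `(τ(g) ⊕ τ(g)) v = (τ(g) v₁, τ(g) v₂)`. [folklore] -/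
theorem diagOp_apply (g : (AutomorphyDatum.gl n K hcpt).arch.carrier) (v : WithLp 2 (E × E)) :
    diagOp τ g v = WithLp.toLp 2 (τ g (WithLp.ofLp v).1, τ g (WithLp.ofLp v).2) := rfl

/-- Unitarity of the diagonal action: `⟪(τ(g) ⊕ τ(g)) v, w⟫ = ⟪v, (τ(g⁻¹) ⊕ τ(g⁻¹)) w⟫`. [folklore] -/
theorem inner_diagOp_left (hτu : τ.IsUnitary) (g : (AutomorphyDatum.gl n K hcpt).arch.carrier)
    (v w : WithLp 2 (E × E)) : ⟪diagOp τ g v, w⟫_ℂ = ⟪v, diagOp τ g⁻¹ w⟫_ℂ := by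
  rw [diagOp_apply, diagOp_apply, WithLp.prod_inner_apply, WithLp.prod_inner_apply]
  change ⟪τ g (WithLp.ofLp v).1, (WithLp.ofLp w).1⟫_ℂ + ⟪τ g (WithLp.ofLp v).2, (WithLp.ofLp w).2⟫_ℂ =
    ⟪(WithLp.ofLp v).1, τ g⁻¹ (WithLp.ofLp w).1⟫_ℂ + ⟪(WithLp.ofLp v).2, τ g⁻¹ (WithLp.ofLp w).2⟫_ℂ
  rw [inner_apply_left_eq_inner_apply_inv hτu, inner_apply_left_eq_inner_apply_inv hτu]

end Diagonal

/-! ### 3. The dichotomy -/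

section Dichotomy

variable {hcpt : isCompact_glFiniteIntegralLevel n K}
  {E : Type*} [NormedAddCommGroup E] [InnerProductSpace ℂ E] [CompleteSpace E]
  {τ : ContRepresentation ℂ (AutomorphyDatum.gl n K hcpt).arch.carrier E}
  {hτ : τ.IsStronglyContinuous} {ℓ₁ ℓ₂ : archGardingSpace hcpt τ →ₗ[ℂ] ℂ}

/-- The span of the pairs `(ξ¹_α, ξ²_α)` is stable under the diagonal action (`G_∞`-covariance of
the Riesz vectors, `apply_whittakerRieszVector`). [folklore] -/
theorem diagOp_mem_span_pairs (h₁ : IsArchContWhittakerFunctional hcpt τ hτ ℓ₁)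
    (h₂ : IsArchContWhittakerFunctional hcpt τ hτ ℓ₂) (hτu : τ.IsUnitary)
    (g : (AutomorphyDatum.gl n K hcpt).arch.carrier) {v : WithLp 2 (E × E)}
    (hv : v ∈ Submodule.span ℂ {v : WithLp 2 (E × E) | ∃ α : GL (Fin n) (mixedSpace K) → ℂ,
      IsArchTestFunction n K α ∧ v = WithLp.toLp 2
        (whittakerRieszVector hcpt τ hτ ℓ₁ α, whittakerRieszVector hcpt τ hτ ℓ₂ α)}) :
    diagOp τ g v ∈ Submodule.span ℂ {v : WithLp 2 (E × E) | ∃ α : GL (Fin n) (mixedSpace K) → ℂ,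
      IsArchTestFunction n K α ∧ v = WithLp.toLp 2
        (whittakerRieszVector hcpt τ hτ ℓ₁ α, whittakerRieszVector hcpt τ hτ ℓ₂ α)} := by
  set S := Submodule.span ℂ {v : WithLp 2 (E × E) | ∃ α : GL (Fin n) (mixedSpace K) → ℂ,
      IsArchTestFunction n K α ∧ v = WithLp.toLp 2
        (whittakerRieszVector hcpt τ hτ ℓ₁ α, whittakerRieszVector hcpt τ hτ ℓ₂ α)} with hS
  have hle : S ≤ S.comap (diagOp τ g).toLinearMap := by
    rw [hS, Submodule.span_le]
    rintro _ ⟨α, hα, rfl⟩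
    change diagOp τ g (WithLp.toLp 2 (whittakerRieszVector hcpt τ hτ ℓ₁ α,
      whittakerRieszVector hcpt τ hτ ℓ₂ α)) ∈ S
    have hg : g = toArch hcpt (g : GL (Fin n) (mixedSpace K)) := Subtype.ext rfl
    rw [diagOp_toLp, hg, apply_whittakerRieszVector h₁ hτu hα, apply_whittakerRieszVector h₂ hτu hα]
    exact Submodule.subset_span ⟨_, hα.comp_mul_right _, rfl⟩
  exact hle hv

/-- **The totality dichotomy for a pair of continuous Whittaker functionals** (first half of
Thomas's multiplicity-free argument, specialised): for `τ` irreducible unitary and continuous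
`ψ_∞`-Whittaker functionals `ℓ₁ ≠ 0`, `ℓ₂` on its Gårding space, if the pairs of Riesz vectors
`(ξ¹_α, ξ²_α)`, `α` a test function, are not total in `E ⊕ E` — their span has a non-trivial
orthogonal complement — then `ℓ₂ = c • ℓ₁`. [cite: Shalika1974, §3] -/
theorem IsArchContWhittakerFunctional.exists_eq_smul_of_orthogonal_pairs_ne_bot
    (h₁ : IsArchContWhittakerFunctional hcpt τ hτ ℓ₁) (h₂ : IsArchContWhittakerFunctional hcpt τ hτ ℓ₂)
    (hτu : τ.IsUnitary) (hτi : τ.IsTopIrreducible) (hne : ℓ₁ ≠ 0)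
    (hK : (Submodule.span ℂ {v : WithLp 2 (E × E) | ∃ α : GL (Fin n) (mixedSpace K) → ℂ,
      IsArchTestFunction n K α ∧ v = WithLp.toLp 2
        (whittakerRieszVector hcpt τ hτ ℓ₁ α, whittakerRieszVector hcpt τ hτ ℓ₂ α)})ᗮ ≠ ⊥) :
    ∃ c : ℂ, ℓ₂ = c • ℓ₁ := by
  set S := Submodule.span ℂ {v : WithLp 2 (E × E) | ∃ α : GL (Fin n) (mixedSpace K) → ℂ,
      IsArchTestFunction n K α ∧ v = WithLp.toLp 2
        (whittakerRieszVector hcpt τ hτ ℓ₁ α, whittakerRieszVector hcpt τ hτ ℓ₂ α)} with hS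
  set L : Submodule ℂ (WithLp 2 (E × E)) := Sᗮ with hL
  haveI : CompleteSpace L := (Submodule.isClosed_orthogonal S).completeSpace_coe
  haveI : L.HasOrthogonalProjection := Submodule.HasOrthogonalProjection.ofCompleteSpace L
  -- notation
  set ξ₁ : (GL (Fin n) (mixedSpace K) → ℂ) → E := whittakerRieszVector hcpt τ hτ ℓ₁ with hξ₁
  set ξ₂ : (GL (Fin n) (mixedSpace K) → ℂ) → E := whittakerRieszVector hcpt τ hτ ℓ₂ with hξ₂
  -- (a) `L` and `Lᗮ` are stable under the diagonal action
  have hSstab : ∀ (g : (AutomorphyDatum.gl n K hcpt).arch.carrier), ∀ v ∈ S, diagOp τ g v ∈ S :=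
    fun g v hv => diagOp_mem_span_pairs h₁ h₂ hτu g hv
  have hLstab : ∀ (g : (AutomorphyDatum.gl n K hcpt).arch.carrier), ∀ x ∈ L, diagOp τ g x ∈ L :=
    fun g x hx => mem_orthogonal_of_forall_inner_eq (inner_diagOp_left hτu g) (hSstab g⁻¹) hx
  have hLostab : ∀ (g : (AutomorphyDatum.gl n K hcpt).arch.carrier), ∀ x ∈ Lᗮ, diagOp τ g x ∈ Lᗮ :=
    fun g x hx => mem_orthogonal_of_forall_inner_eq (inner_diagOp_left hτu g) (hLstab g⁻¹) hx
  -- (b) the projection `Q` onto `L` commutes with the diagonal action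
  set Q := L.starProjection with hQ
  have hQcomm : ∀ (g : (AutomorphyDatum.gl n K hcpt).arch.carrier) (x : WithLp 2 (E × E)),
      Q (diagOp τ g x) = diagOp τ g (Q x) := fun g x =>
    starProjection_apply_of_stable_orthogonal (hLstab g) (hLostab g) x
  -- (c) the four blocks of `Q` commute with `τ`, hence are scalars (Schur)
  let ι₁ : E →L[ℂ] WithLp 2 (E × E) :=
    ((WithLp.prodContinuousLinearEquiv 2 ℂ E E).symm : (E × E) →L[ℂ] WithLp 2 (E × E)) ∘L
      ContinuousLinearMap.inl ℂ E E
  let ι₂ : E →L[ℂ] WithLp 2 (E × E) :=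
    ((WithLp.prodContinuousLinearEquiv 2 ℂ E E).symm : (E × E) →L[ℂ] WithLp 2 (E × E)) ∘L
      ContinuousLinearMap.inr ℂ E E
  let π₁ : WithLp 2 (E × E) →L[ℂ] E := WithLp.fstL 2 ℂ E E
  let π₂ : WithLp 2 (E × E) →L[ℂ] E := WithLp.sndL 2 ℂ E E
  have hι₁ : ∀ x : E, ι₁ x = WithLp.toLp 2 (x, 0) := fun x => rfl
  have hι₂ : ∀ y : E, ι₂ y = WithLp.toLp 2 (0, y) := fun y => rfl
  have hπ₁ : ∀ v : WithLp 2 (E × E), π₁ v = (WithLp.ofLp v).1 := fun v => rfl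
  have hπ₂ : ∀ v : WithLp 2 (E × E), π₂ v = (WithLp.ofLp v).2 := fun v => rfl
  have hblock : ∀ (πi : WithLp 2 (E × E) →L[ℂ] E) (ιj : E →L[ℂ] WithLp 2 (E × E)),
      (∀ g v, πi (diagOp τ g v) = τ g (πi v)) → (∀ g x, ιj (τ g x) = diagOp τ g (ιj x)) →
        ∃ q : ℂ, ∀ x : E, πi (Q (ιj x)) = q • x := by
    intro πi ιj hπ hι
    refine hτi.exists_apply_eq_smul_of_commute hτu (T := πi ∘L Q ∘L ιj) fun g => ?_
    refine ContinuousLinearMap.ext fun x => ?_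
    change τ g (πi (Q (ιj x))) = πi (Q (ιj (τ g x)))
    rw [hι, hQcomm, hπ]
  have hπ₁g : ∀ g v, π₁ (diagOp τ g v) = τ g (π₁ v) := fun g v => rfl
  have hπ₂g : ∀ g v, π₂ (diagOp τ g v) = τ g (π₂ v) := fun g v => rfl
  have hι₁g : ∀ g x, ι₁ (τ g x) = diagOp τ g (ι₁ x) := fun g x => by
    rw [hι₁, hι₁, diagOp_toLp, map_zero]
  have hι₂g : ∀ g x, ι₂ (τ g x) = diagOp τ g (ι₂ x) := fun g x => by
    rw [hι₂, hι₂, diagOp_toLp, map_zero]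
  obtain ⟨q₁₁, hq₁₁⟩ := hblock π₁ ι₁ hπ₁g hι₁g
  obtain ⟨q₁₂, hq₁₂⟩ := hblock π₁ ι₂ hπ₁g hι₂g
  obtain ⟨q₂₁, hq₂₁⟩ := hblock π₂ ι₁ hπ₂g hι₁g
  obtain ⟨q₂₂, hq₂₂⟩ := hblock π₂ ι₂ hπ₂g hι₂g
  -- (d) `Q (x, y)` in terms of the scalars
  have hQxy : ∀ x y : E, Q (WithLp.toLp 2 (x, y)) =
      WithLp.toLp 2 (q₁₁ • x + q₁₂ • y, q₂₁ • x + q₂₂ • y) := by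
    intro x y
    have hsplit : (WithLp.toLp 2 (x, y) : WithLp 2 (E × E)) = ι₁ x + ι₂ y := by
      rw [hι₁, hι₂, ← WithLp.toLp_add, Prod.mk_add_mk, add_zero, zero_add]
    rw [hsplit, map_add]
    refine (WithLp.ofLp_injective 2).eq_iff.1 (Prod.ext ?_ ?_)
    · change π₁ (Q (ι₁ x) + Q (ι₂ y)) = q₁₁ • x + q₁₂ • y
      rw [map_add, hq₁₁, hq₁₂]
    · change π₂ (Q (ι₁ x) + Q (ι₂ y)) = q₂₁ • x + q₂₂ • y
      rw [map_add, hq₂₁, hq₂₂]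
  -- (e) `Q` kills the pairs
  have hQpair : ∀ α : GL (Fin n) (mixedSpace K) → ℂ, IsArchTestFunction n K α →
      q₁₁ • ξ₁ α + q₁₂ • ξ₂ α = 0 ∧ q₂₁ • ξ₁ α + q₂₂ • ξ₂ α = 0 := by
    intro α hα
    have hmem : (WithLp.toLp 2 (ξ₁ α, ξ₂ α) : WithLp 2 (E × E)) ∈ Lᗮ := by
      rw [hL]
      exact S.le_orthogonal_orthogonal (Submodule.subset_span ⟨α, hα, rfl⟩)
    have h0 : Q (WithLp.toLp 2 (ξ₁ α, ξ₂ α)) = 0 :=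
      (Submodule.starProjection_apply_eq_zero_iff L).2 hmem
    rw [hQxy] at h0
    have h0' := congrArg (WithLp.ofLp) h0
    rw [WithLp.ofLp_toLp, WithLp.ofLp_zero] at h0'
    exact ⟨congrArg Prod.fst h0', congrArg Prod.snd h0'⟩
  -- (f) not all `q_ij` vanish (else `Q = 0`, `L = ⊥`)
  have hq : ¬ (q₁₁ = 0 ∧ q₁₂ = 0 ∧ q₂₁ = 0 ∧ q₂₂ = 0) := by
    rintro ⟨rfl, rfl, rfl, rfl⟩
    apply hK
    change L = ⊥
    rw [← Submodule.range_starProjection L, LinearMap.range_eq_bot]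
    refine LinearMap.ext fun v => ?_
    change Q v = 0
    have hv : v = WithLp.toLp 2 ((WithLp.ofLp v).1, (WithLp.ofLp v).2) := by
      rw [Prod.mk.eta, WithLp.toLp_ofLp]
    rw [hv, hQxy]
    simp only [zero_smul, add_zero]
    rfl
  -- (g) some `ξ₁ α ≠ 0`
  obtain ⟨α₀, hα₀, hξ₀⟩ := h₁.exists_whittakerRieszVector_ne_zero hτu hne
  -- (h) case analysis on the scalars
  by_cases h12 : q₁₂ = 0
  · by_cases h22 : q₂₂ = 0
    · -- then `q₁₁ ξ₁ = 0 = q₂₁ ξ₁`, and one of `q₁₁, q₂₁` is non-zero: contradiction with `ξ₁ α₀ ≠ 0`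
      exfalso
      have hr := hQpair α₀ hα₀
      rw [h12, zero_smul, add_zero, h22, zero_smul, add_zero] at hr
      rcases hr with ⟨hr₁, hr₂⟩
      by_cases h11 : q₁₁ = 0
      · have h21 : q₂₁ ≠ 0 := fun h21 => hq ⟨h11, h12, h21, h22⟩
        exact hξ₀ ((smul_eq_zero.1 hr₂).resolve_left h21)
      · exact hξ₀ ((smul_eq_zero.1 hr₁).resolve_left h11)
    · -- `ξ₂ α = -(q₂₁ / q₂₂) ξ₁ α`
      refine ⟨conj (-(q₂₁ / q₂₂)), h₁.eq_smul_of_whittakerRieszVector_eq_smul h₂ hτu _ fun α hα => ?_⟩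
      have hr := (hQpair α hα).2
      change ξ₂ α = -(q₂₁ / q₂₂) • ξ₁ α
      have : q₂₂ • ξ₂ α = -(q₂₁ • ξ₁ α) := eq_neg_of_add_eq_zero_right hr
      calc ξ₂ α = q₂₂⁻¹ • (q₂₂ • ξ₂ α) := by rw [smul_smul, inv_mul_cancel₀ h22, one_smul]
        _ = -(q₂₁ / q₂₂) • ξ₁ α := by rw [this, smul_neg, smul_smul, neg_smul, div_eq_inv_mul]
  · -- `ξ₂ α = -(q₁₁ / q₁₂) ξ₁ α`
    refine ⟨conj (-(q₁₁ / q₁₂)), h₁.eq_smul_of_whittakerRieszVector_eq_smul h₂ hτu _ fun α hα => ?_⟩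
    have hr := (hQpair α hα).1
    change ξ₂ α = -(q₁₁ / q₁₂) • ξ₁ α
    have : q₁₂ • ξ₂ α = -(q₁₁ • ξ₁ α) := eq_neg_of_add_eq_zero_right hr
    calc ξ₂ α = q₁₂⁻¹ • (q₁₂ • ξ₂ α) := by rw [smul_smul, inv_mul_cancel₀ h12, one_smul]
      _ = -(q₁₁ / q₁₂) • ξ₁ α := by rw [this, smul_neg, smul_smul, neg_smul, div_eq_inv_mul]

/-- **Rank form of the dichotomy**: if for every pair of continuous `ψ_∞`-Whittaker functionals
`ℓ₁ ≠ 0`, `ℓ₂` on the irreducible unitary `τ` the pairs of Riesz vectors are not total in `E ⊕ E`,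
then `archContWhittakerFunctionals hcpt τ hτ` has dimension `≤ 1`. (Excluding totality is the
content of the Gelfand–Kazhdan/Shalika symmetry of quasi-invariant distributions, via the second
half of Thomas's argument; not done here.) [cite: Shalika1974, §3] -/
theorem rank_archContWhittakerFunctionals_le_one_of_pairs_not_total (hτu : τ.IsUnitary)
    (hτi : τ.IsTopIrreducible) (hτ : τ.IsStronglyContinuous)
    (H : ∀ ℓ₁ ℓ₂ : archGardingSpace hcpt τ →ₗ[ℂ] ℂ, IsArchContWhittakerFunctional hcpt τ hτ ℓ₁ →
      IsArchContWhittakerFunctional hcpt τ hτ ℓ₂ → ℓ₁ ≠ 0 →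
        (Submodule.span ℂ {v : WithLp 2 (E × E) | ∃ α : GL (Fin n) (mixedSpace K) → ℂ,
          IsArchTestFunction n K α ∧ v = WithLp.toLp 2
            (whittakerRieszVector hcpt τ hτ ℓ₁ α, whittakerRieszVector hcpt τ hτ ℓ₂ α)})ᗮ ≠ ⊥) :
    Module.rank ℂ (archContWhittakerFunctionals hcpt τ hτ) ≤ 1 := by
  rw [rank_submodule_le_one_iff']
  by_cases h0 : ∀ ℓ ∈ archContWhittakerFunctionals hcpt τ hτ, ℓ = 0
  · refine ⟨0, fun ℓ hℓ => ?_⟩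
    rw [h0 ℓ hℓ]
    exact Submodule.zero_mem _
  · push Not at h0
    obtain ⟨ℓ₁, hℓ₁, hne⟩ := h0
    refine ⟨ℓ₁, fun ℓ₂ hℓ₂ => ?_⟩
    obtain ⟨c, hc⟩ := IsArchContWhittakerFunctional.exists_eq_smul_of_orthogonal_pairs_ne_bot
      hℓ₁ hℓ₂ hτu hτi hne (H ℓ₁ ℓ₂ hℓ₁ hℓ₂ hne)
    exact Submodule.mem_span_singleton.2 ⟨c, hc.symm⟩

end Dichotomy

end Literature.NumberTheory.Automorphic
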